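import Summits.Ventures.PercRepro.RankLevelSetDepCountMult
import Summits.Ventures.PercRepro.RankLevelSetLevelSix
import Summits.Ventures.PercRepro.RankLevelSetLevelSixArithMult4H
import Summits.Ventures.PercRepro.S1FourCircuitCount
import Summits.Ventures.PercRepro.RankLevelSetPlaneSix
import Summits.Ventures.PercRepro.S1TriangleCount
import Summits.Ventures.PercRepro.RankLevelSetTriangleStar
import Summits.Ventures.PercRepro.RankLevelSetCorankFiveCounts
import Summits.Ventures.PercRepro.RankLevelSetPlaneTen
import Summits.Ventures.PercRepro.RankLevelSetCoreFour
import Summits.Ventures.PercRepro.RankLevelSetFrameLarge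
import Summits.Ventures.PercRepro.RankLevelSetFrameQM
import Summits.Ventures.PercRepro.RankLevelSetLevelFiveAll

/-!
# PercRepro — THEOREM C₆, CAP + LEMMA T + MULTIPLICITY + LEMMA T4: C-025 AT LEVEL `6` FOR EVERY FINITE MATROID AND
EVERY `p ≥ 256`, GIVEN LEVEL `5` (p8, S3)

`proofs/SUBCLAIM-S3-p8.md` §3c. The level-`6` assembly of `RankLevelSetLevelSixCapT` with night-1's MULTIPLICITY
lever (`ncard_eRk_eq_ncard_eq_mul_le`, RankLevelSetDepCountMult: a dependent rank-`q` set of `m` elements is reached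
from at least `m − q` pairs `(C, B′)`, so the level-`m` count carries the factor `m − q`) summed over the sizes
`7 ≤ m ≤ d` (`ncard_eRk_eq_ncard_le_le_sum`): the fibre sums become `σ^mult = Σ_j C(·, j)/(j + 1)` — with the
nullity cap `f = min 43 (6 + d)`, `f′ = min 21 (5 + d)` and Lemma T `s₃ ≤ d(d + 1)/2`, the polynomial inequalities
`level_six_poly_mult4` (`RankLevelSetLevelSixArithMult4A … H`, in `ℚ`) hold from `p ≥ 255` (binding corank `d = 37`;
`254` fails there) — the fourth ingredient being p2's LEMMA T4 (`S1.three_mul_ncard_four_circuits_le`,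
S1FourCircuitCount d1062: `3·s₄ ≤ d(d + 1)(d + 2)` on the core, lines `≤ 3` and planes `≤ 6` points):
`c025_core_six_bounded_corank_mult4`, `c025_six_of_five_mult4` (level `5` for all `p ≥ 255` ⇒ level `6` for all
`p ≥ 256`) and, over the tree of record (THEOREM C₅ `c025_five_large`, `p ≥ 835`), the unconditional
`c025_six_large_mult4' : 836 ≤ p → RLS M p 6`. Adapted from night-1 g4's RankLevelSetLevelSixSplit.lean.
Axioms: standard.
-/

open scoped Matroid

namespace PercRepro

namespace ThmN

open Set

variable {α : Type}

/-- **The `e`-free core at level `6`, corank `7 ≤ d ≤ 50`, rank `p ≥ 255`** (split count, nullity cap, Lemma T, multiplicity, Lemma T4). -/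
theorem c025_core_six_bounded_corank_mult4 (M : Matroid α) [M.Finite] (p d : ℕ) (hp : 255 ≤ p) (hd7 : 7 ≤ d)
    (hd50 : d ≤ 50) (hR : M.eRank = (p : ℕ∞)) (hn : M.E.ncard = p + d)
    (hfree : ∀ e ∈ M.E, ∃ A ⊆ M.E \ {e}, e ∉ M.closure A ∧ e ∉ M.closure ((M.E \ {e}) \ A)) :
    RLS M p 6 := by
  classical
  have hEcard : M.ground_finite.toFinset.card = p + d := by
    rw [← Set.ncard_eq_toFinset_card _ M.ground_finite]; exact hn
  -- the core is simple: every circuit has `≥ 3` elements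
  have hL : ∀ e ∈ M.E, ¬ M.IsLoop e := not_isLoop_of_free M hfree
  have hs : ∀ e ∈ M.E, ∀ f ∈ M.E, e ≠ f → M.eRk {e, f} = 2 := by
    intro e he f hf hef
    have h2 : (2 : ℕ∞) ≤ M.eRk {e, f} :=
      two_le_eRk_of_two_le_ncard_of_free M hfree (pair_subset he hf) (by rw [ncard_pair hef])
    have h3 : M.eRk {e, f} ≤ 2 := by
      have := M.eRk_le_encard {e, f}
      rwa [encard_pair hef] at this
    exact le_antisymm h3 h2
  have hcirc : ∀ C, M.IsCircuit C → 3 ≤ C.encard := three_le_encard_of_circuit M hL hs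
  -- rank-`≤ 6` sets have `≤ 43` points
  have hd : M.E.encard = M.eRank + d := by
    rw [hR, ← M.ground_finite.cast_ncard_eq, hn]
    push_cast
    ring
  -- the nullity cap: every `X ⊆ E` has `|X| ≤ r(X) + d`
  have hcap : ∀ X ⊆ M.E, ∀ k : ℕ, M.eRk X ≤ k → X.ncard ≤ k + d := by
    intro X hX k hr
    have h1 := Matroid.encard_le_eRk_add_of_encard_eq hX hd
    have h2 : X.encard ≤ (k : ℕ∞) + d := h1.trans (by gcongr)
    have hfin : X.Finite := M.ground_finite.subset hX
    rw [← hfin.cast_ncard_eq] at h2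
    exact_mod_cast h2
  have hflat : ∀ X ⊆ M.E, M.eRk X ≤ 6 → X.ncard ≤ min 43 (6 + d) :=
    fun X hX hr => le_min (ncard_le_fortythree_of_eRk_le_six_of_free M hfree hX hr) (hcap X hX 6 hr)
  -- (U)
  have hflat' : ∀ X ⊆ M.E, M.eRk X ≤ ((6 - 1 : ℕ) : ℕ∞) → X.ncard ≤ min 21 (5 + d) :=
    fun X hX hr => le_min (ncard_le_twentyone_of_eRk_le_five_of_free M hfree hX (by simpa using hr))
      (hcap X hX 5 (by simpa using hr))
  have hU1 := Matroid.topCount_le_ncard_compl (M := M) hR hd 6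
  have hsum := Matroid.ncard_eRk_eq_ncard_le_le_sum (M := M) 6 d
  have hmul := fun m => Matroid.ncard_eRk_eq_ncard_eq_mul_le M 6 (min 43 (6 + d)) (min 21 (5 + d))
    (by norm_num) hcirc hflat hflat' hd m
  have hC1 : ∀ L ⊆ M.E, M.eRk L = 2 → L.ncard ≤ 3 :=
    fun L hL hr => ncard_le_three_of_eRk_two M hs hfree hL hr
  have hs3 : {C | M.IsCircuit C ∧ C.ncard = 3}.ncard ≤ d * (d + 1) / 2 := by
    have hT : 2 * {C | M.IsCircuit C ∧ C.ncard = 3}.ncard ≤ d * (d + 1) := S1.two_mul_ncard_triangles_le M hC1 hd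
    omega
  have hC2 : ∀ P ⊆ M.E, M.eRk P ≤ 3 → P.ncard ≤ 6 :=
    fun P hP hr => ncard_le_six_of_eRk_le_three_of_free M hfree hP hr
  have hC1' : ∀ L ⊆ M.E, M.eRk L ≤ 2 → L.ncard ≤ 3 := by
    intro L hL' hr
    have := ncard_add_one_le_two_pow_of_eRk_le M hL hfree 2 L hL' hr
    omega
  have hs4 : {C | M.IsCircuit C ∧ C.ncard = 4}.ncard ≤ d * (d + 1) * (d + 2) / 3 := by
    have hT4 : 3 * {C : Set α | M.IsCircuit C ∧ C.ncard = 4}.ncard ≤ d * (d + 1) * (d + 2) :=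
      S1.three_mul_ncard_four_circuits_le M hC1' hC2 hd
    omega
  have hs5 : {C | M.IsCircuit C ∧ C.ncard = 5}.ncard ≤ (d + 4).choose 5 :=
    Matroid.ncard_circuits_le_choose_of_encard M hd 4
  have hs6 : {C | M.IsCircuit C ∧ C.ncard = 6}.ncard ≤ (d + 5).choose 6 :=
    Matroid.ncard_circuits_le_choose_of_encard M hd 5
  have hs7 : {C | M.IsCircuit C ∧ C.ncard = 7}.ncard ≤ (d + 6).choose 7 :=
    Matroid.ncard_circuits_le_choose_of_encard M hd 6
  -- the two pair sums, bounded
  set A : ℕ := ∑ k ∈ Finset.Icc 3 (6 + 1), {C | M.IsCircuit C ∧ C.ncard = k}.ncard * M.E.ncard.choose (6 + 1 - k)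
    with hAdef
  set B : ℕ := ∑ k ∈ Finset.Icc 3 (6 + 1), {C | M.IsCircuit C ∧ C.ncard = k}.ncard * ((6 + 1) * d).choose (6 + 1 - k)
    with hBdef
  have hA : A ≤ d * (d + 1) / 2 * (p + d).choose 4 + d * (d + 1) * (d + 2) / 3 * (p + d).choose 3 +
      (d + 4).choose 5 * (p + d).choose 2 + (d + 5).choose 6 * (p + d) + (d + 6).choose 7 := by
    rw [hAdef, sum_Icc_three_seven, hn]
    simp only [show (6 : ℕ) + 1 - 3 = 4 from rfl, show (6 : ℕ) + 1 - 4 = 3 from rfl,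
      show (6 : ℕ) + 1 - 5 = 2 from rfl, show (6 : ℕ) + 1 - 6 = 1 from rfl,
      show (6 : ℕ) + 1 - 7 = 0 from rfl, Nat.choose_one_right, Nat.choose_zero_right, mul_one]
    gcongr
  have hB : B ≤ d * (d + 1) / 2 * (7 * d).choose 4 + d * (d + 1) * (d + 2) / 3 * (7 * d).choose 3 +
      (d + 4).choose 5 * (7 * d).choose 2 + (d + 5).choose 6 * (7 * d) + (d + 6).choose 7 := by
    rw [hBdef, sum_Icc_three_seven]
    simp only [show (6 : ℕ) + 1 - 3 = 4 from rfl, show (6 : ℕ) + 1 - 4 = 3 from rfl,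
      show (6 : ℕ) + 1 - 5 = 2 from rfl, show (6 : ℕ) + 1 - 6 = 1 from rfl,
      show (6 : ℕ) + 1 - 7 = 0 from rfl, Nat.choose_one_right, Nat.choose_zero_right, mul_one,
      show (6 : ℕ) + 1 = 7 from rfl]
    gcongr
  -- the level counts in `ℚ`, weighted
  have hlevel : ∀ m ∈ Finset.Icc 7 d, ({X : Set α | X ⊆ M.E ∧ M.eRk X = 6 ∧ X.ncard = m}.ncard : ℚ) ≤
      (((min 21 (5 + d) - 6).choose (m - 7) : ℚ) * (A : ℚ) + ((min 43 (6 + d) - 7).choose (m - 7) : ℚ) * (B : ℚ)) /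
        ((m - 6 : ℕ) : ℚ) := by
    intro m hm
    rw [Finset.mem_Icc] at hm
    have hpos : (0 : ℚ) < ((m - 6 : ℕ) : ℚ) := by exact_mod_cast (by omega : 0 < m - 6)
    rw [le_div_iff₀ hpos]
    have h := hmul m
    simp only [show (6 : ℕ) + 1 = 7 from rfl] at h
    have h' : (((m - 6) * {X : Set α | X ⊆ M.E ∧ M.eRk X = 6 ∧ X.ncard = m}.ncard : ℕ) : ℚ) ≤
        (((min 21 (5 + d) - 6).choose (m - 7) * A + (min 43 (6 + d) - 7).choose (m - 7) * B : ℕ) : ℚ) := by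
      exact_mod_cast h
    push_cast at h'
    linarith
  have hre : ∑ m ∈ Finset.Icc 7 d,
      (((min 21 (5 + d) - 6).choose (m - 7) : ℚ) * (A : ℚ) + ((min 43 (6 + d) - 7).choose (m - 7) : ℚ) * (B : ℚ)) /
        ((m - 6 : ℕ) : ℚ) =
      ∑ j ∈ Finset.range (d - 6),
      (((min 21 (5 + d) - 6).choose j : ℚ) * (A : ℚ) + ((min 43 (6 + d) - 7).choose j : ℚ) * (B : ℚ)) / ((j : ℚ) + 1) := by
    rw [show Finset.Icc 7 d = Finset.image (fun j => 7 + j) (Finset.range (d - 6)) from ?_]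
    · rw [Finset.sum_image (fun a _ b _ h => by omega)]
      apply Finset.sum_congr rfl
      intro j _
      rw [show 7 + j - 7 = j by omega, show 7 + j - 6 = j + 1 by omega]
      push_cast
      ring
    · ext m
      rw [Finset.mem_Icc, Finset.mem_image]
      constructor
      · intro hm
        exact ⟨m - 7, by rw [Finset.mem_range]; omega, by omega⟩
      · rintro ⟨j, hj, rfl⟩
        rw [Finset.mem_range] at hj
        omega
  have hrange : Finset.range (d - 6) ⊆ Finset.range (d - 7 + 1) := Finset.range_mono (by omega)
  have hUq : (Matroid.topCount M p 6 : ℚ) ≤ ((p + d).choose 6 : ℚ) +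
      (((∑ j ∈ Finset.range (d - 7 + 1), ((Nat.choose (min 21 (5 + d) - 6) j : ℕ) : ℚ) / ((j : ℚ) + 1)) *
        (((d * (d + 1) / 2 : ℕ) : ℚ) * ((p + d).choose 4 : ℚ) + ((d * (d + 1) * (d + 2) / 3 : ℕ) : ℚ) * ((p + d).choose 3 : ℚ) +
          (((d + 4).choose 5 : ℕ) : ℚ) * ((p + d).choose 2 : ℚ) + (((d + 5).choose 6 : ℕ) : ℚ) * (p + d : ℚ) +
          (((d + 6).choose 7 : ℕ) : ℚ)) +
      (∑ j ∈ Finset.range (d - 7 + 1), ((Nat.choose (min 43 (6 + d) - 7) j : ℕ) : ℚ) / ((j : ℚ) + 1)) *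
        (((d * (d + 1) / 2 : ℕ) : ℚ) * ((7 * d).choose 4 : ℚ) + ((d * (d + 1) * (d + 2) / 3 : ℕ) : ℚ) * ((7 * d).choose 3 : ℚ) +
          (((d + 4).choose 5 : ℕ) : ℚ) * ((7 * d).choose 2 : ℚ) + (((d + 5).choose 6 : ℕ) : ℚ) * (7 * d : ℚ) +
          (((d + 6).choose 7 : ℕ) : ℚ)))) := by
    have h1 : (Matroid.topCount M p 6 : ℚ) ≤ ((p + d).choose 6 : ℚ) +
        ∑ m ∈ Finset.Icc 7 d, ({X : Set α | X ⊆ M.E ∧ M.eRk X = 6 ∧ X.ncard = m}.ncard : ℚ) := by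
      have := hU1.trans hsum
      rw [hn] at this
      simp only [show (6 : ℕ) + 1 = 7 from rfl] at this
      exact_mod_cast this
    have hAq : (A : ℚ) ≤ (((d * (d + 1) / 2 : ℕ) : ℚ) * ((p + d).choose 4 : ℚ) + ((d * (d + 1) * (d + 2) / 3 : ℕ) : ℚ) * ((p + d).choose 3 : ℚ) +
          (((d + 4).choose 5 : ℕ) : ℚ) * ((p + d).choose 2 : ℚ) + (((d + 5).choose 6 : ℕ) : ℚ) * (p + d : ℚ) +
          (((d + 6).choose 7 : ℕ) : ℚ)) := by exact_mod_cast hA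
    have hBq : (B : ℚ) ≤ (((d * (d + 1) / 2 : ℕ) : ℚ) * ((7 * d).choose 4 : ℚ) + ((d * (d + 1) * (d + 2) / 3 : ℕ) : ℚ) * ((7 * d).choose 3 : ℚ) +
          (((d + 4).choose 5 : ℕ) : ℚ) * ((7 * d).choose 2 : ℚ) + (((d + 5).choose 6 : ℕ) : ℚ) * (7 * d : ℚ) +
          (((d + 6).choose 7 : ℕ) : ℚ)) := by exact_mod_cast hB
    have hσs0 : (0 : ℚ) ≤ ∑ j ∈ Finset.range (d - 7 + 1), ((Nat.choose (min 21 (5 + d) - 6) j : ℕ) : ℚ) / ((j : ℚ) + 1) :=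
      Finset.sum_nonneg (fun j _ => by positivity)
    have hσ0 : (0 : ℚ) ≤ ∑ j ∈ Finset.range (d - 7 + 1), ((Nat.choose (min 43 (6 + d) - 7) j : ℕ) : ℚ) / ((j : ℚ) + 1) :=
      Finset.sum_nonneg (fun j _ => by positivity)
    have h2 : ∑ m ∈ Finset.Icc 7 d, ({X : Set α | X ⊆ M.E ∧ M.eRk X = 6 ∧ X.ncard = m}.ncard : ℚ) ≤
        (∑ j ∈ Finset.range (d - 7 + 1), ((Nat.choose (min 21 (5 + d) - 6) j : ℕ) : ℚ) / ((j : ℚ) + 1)) * (A : ℚ) +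
        (∑ j ∈ Finset.range (d - 7 + 1), ((Nat.choose (min 43 (6 + d) - 7) j : ℕ) : ℚ) / ((j : ℚ) + 1)) * (B : ℚ) := by
      rw [Finset.sum_mul, Finset.sum_mul, ← Finset.sum_add_distrib]
      refine (Finset.sum_le_sum hlevel).trans (hre.le.trans ?_)
      refine Finset.sum_le_sum_of_subset_of_nonneg hrange (fun j _ _ => by positivity) |>.trans' ?_
      apply le_of_eq
      apply Finset.sum_congr rfl
      intro j _
      field_simp
    have e1 := mul_le_mul_of_nonneg_left hAq hσs0
    have e2 := mul_le_mul_of_nonneg_left hBq hσ0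
    linarith
  -- (Y)
  have hY := Matroid.two_pow_le_midCount_add (M := M) p 6 hR
  have hA : {X : Set α | X ⊆ M.E ∧ M.eRk X ≤ 6}.ncard ≤ ∑ j ∈ Finset.range (43 + 1), (p + d).choose j := by
    calc {X : Set α | X ⊆ M.E ∧ M.eRk X ≤ 6}.ncard
        ≤ {X : Set α | X ⊆ (M.ground_finite.toFinset : Set α) ∧ X.ncard ≤ 43}.ncard := by
          apply ncard_le_ncard
          · intro X hX
            exact ⟨by rw [Set.Finite.coe_toFinset]; exact hX.1, (hflat X hX.1 hX.2).trans (min_le_left _ _)⟩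
          · exact (Finset.finite_toSet _).finite_subsets.subset (fun X hX => hX.1)
      _ ≤ ∑ j ∈ Finset.range (43 + 1), M.ground_finite.toFinset.card.choose j :=
          ncard_subsets_ncard_le _ 43
      _ = ∑ j ∈ Finset.range (43 + 1), (p + d).choose j := by rw [hEcard]
  have hB := Matroid.ncard_spanning_le (M := M) hd
  rw [hEcard] at hY hB
  -- the tails
  have hT : 16 * ∑ j ∈ Finset.range 51, (p + d).choose j ≤ 2 ^ (p + d) :=
    sixteen_mul_sum_choose_le_fifty (p + d) (by omega)
  have hA' : ∑ j ∈ Finset.range (43 + 1), (p + d).choose j ≤ ∑ j ∈ Finset.range 51, (p + d).choose j :=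
    Finset.sum_le_sum_of_subset_of_nonneg (Finset.range_mono (by norm_num)) (fun _ _ _ => Nat.zero_le _)
  have hB' : ∑ j ∈ Finset.range (d + 1), (p + d).choose j ≤ ∑ j ∈ Finset.range 51, (p + d).choose j :=
    Finset.sum_le_sum_of_subset_of_nonneg (Finset.range_mono (by omega)) (fun _ _ _ => Nat.zero_le _)
  have hAB : 8 * ({X : Set α | X ⊆ M.E ∧ M.eRk X ≤ 6}.ncard +
      {X : Set α | X ⊆ M.E ∧ M.eRk X = M.eRank}.ncard) ≤ 2 ^ (p + d) := by
    have h1 := hA.trans hA'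
    have h2 := hB.trans hB'
    omega
  -- (Φ) and the polynomial inequality
  have hΦ := phiK_le_two_pow_div p 6
  rw [Nat.choose_symm_add] at hΦ
  have hpolyq := level_six_poly_mult4 d hd7 hd50 p hp
  rw [add_assoc] at hpolyq
  -- assemble in `ℚ`
  rw [RLS_iff]
  have hYq : (2 : ℚ) ^ (p + d) ≤ (Matroid.midCount M p 6 : ℚ) +
      ({X : Set α | X ⊆ M.E ∧ M.eRk X ≤ 6}.ncard : ℚ) +
      ({X : Set α | X ⊆ M.E ∧ M.eRk X = M.eRank}.ncard : ℚ) := by exact_mod_cast hY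
  have hABq : 8 * (({X : Set α | X ⊆ M.E ∧ M.eRk X ≤ 6}.ncard : ℚ) +
      ({X : Set α | X ⊆ M.E ∧ M.eRk X = M.eRank}.ncard : ℚ)) ≤ 2 ^ (p + d) := by exact_mod_cast hAB
  have hU0 : (0 : ℚ) ≤ (Matroid.topCount M p 6 : ℚ) := Nat.cast_nonneg _
  have hd6 : 6 ≤ d := by omega
  exact level_arith (p := p) (d := d) (n := p + d) (q := 6) rfl hd6 hΦ hU0 hUq hYq hABq hpolyq

/-- **THEOREM C₆, CAP + LEMMA T + MULTIPLICITY + LEMMA T4, GIVEN LEVEL `5`**: level `5` for all `p ≥ 255` implies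
level `6` for all `p ≥ 256`. -/
theorem c025_six_of_five_mult4 (h5 : ∀ (M : Matroid α) [M.Finite] (p : ℕ), 255 ≤ p → RLS M p 5) :
    ∀ (M : Matroid α) [M.Finite] (p : ℕ), 256 ≤ p → RLS M p 6 := by
  intro M _ p hp
  refine rls_succ_large (α := α) 5 6 255 ?_ ?_ ?_ M p hp (by omega)
  · -- level `5` for `p ≥ 255`
    intro M' _ p' hP _
    exact h5 M' p' (by omega)
  · -- corank `≤ 6`: `U = ∅` or Theorem M
    intro M' _ p' _ hn _
    rcases Nat.lt_or_ge M'.E.ncard (p' + 6) with h | h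
    · exact RLS_of_ncard_lt M' h
    · exact RLS_of_ncard_eq M' (by omega)
  · -- the core: coranks `7 … 50` by counting, coranks `≥ 51` by `c025_core_six_fortythree`
    intro M' _ p' hP hR hbig _ hfree
    rcases Nat.lt_or_ge M'.E.ncard (p' + 51) with h | h
    · exact c025_core_six_bounded_corank_mult4 M' p' (M'.E.ncard - p') hP (by omega) (by omega) hR (by omega) hfree
    · exact c025_core_six_fortythree M' p' (by omega) hR (by omega) hfree

/-- **THEOREM C₆, CAP + LEMMA T + MULTIPLICITY + LEMMA T4, UNCONDITIONAL OVER THE TREE OF RECORD**: every finite matroid satisfies C-025 at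
level `6` for every `p ≥ 836` — THEOREM C₅ (`c025_five_large`, level `5` for `p ≥ 835`) through the wrapper at `P = 835`
with the core theorem (which holds from `p ≥ 255`). The threshold `256` needs level `5` from `p ≥ 255`
(`c025_six_of_five_mult4`). -/
theorem c025_six_large_mult4' (M : Matroid α) [M.Finite] (p : ℕ) (hp : 836 ≤ p) : RLS M p 6 := by
  refine rls_succ_large (α := α) 5 6 835 ?_ ?_ ?_ M p hp (by omega)
  · intro M' _ p' hP _
    exact c025_five_large M' p' hP
  · intro M' _ p' _ hn _
    rcases Nat.lt_or_ge M'.E.ncard (p' + 6) with h | h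
    · exact RLS_of_ncard_lt M' h
    · exact RLS_of_ncard_eq M' (by omega)
  · intro M' _ p' hP hR hbig _ hfree
    rcases Nat.lt_or_ge M'.E.ncard (p' + 51) with h | h
    · exact c025_core_six_bounded_corank_mult4 M' p' (M'.E.ncard - p') (by omega) (by omega) (by omega) hR (by omega)
        hfree
    · exact c025_core_six_fortythree M' p' (by omega) hR (by omega) hfree

end ThmN

end PercRepro
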